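import Summits.NavierStokesRegularity.NavierStokesRegularity.Theses.LocalHelicityTubeDoor
import Literature.Analysis.FluidPDE.ParasiticSlabFlow

/-!
# `FrobeniusProfileRigidity` (crux stmt-NavierStokesRegularity-19975, route LocalHelicityTubeDoor):
# normal form in the Type-I constant and the load-bearing Navier–Stokes hypothesis — negative-side
# support (refuter batch pass)

Sorry-free lemmas about the crux
`Summit.NavierStokesRegularity.NavierStokesRegularity.Theses.LocalHelicityTubeDoor.FrobeniusProfileRigidity`
("a Type-I-rate, continuous, unit-viscosity Oseen-mild, divergence-free ancient field on `(−∞,0) × ℝ³` whose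
helicity density `⟪v, curl v⟫` vanishes on every slice is not backward-singular at the apex `(0,0)`"),
for ideators, planners and provers to IMPORT (no `def`, no route-cone import):

* §0 NORMAL FORM IN THE CONSTANT: `not_isBackwardSingularPoint_zero_of_forall_eq_zero` (a field vanishing
  on the open past slab is not singular at the origin), `frobeniusProfileRigidity_of_nonpos` (`C ≤ 0`
  forces `v = 0` on `t < 0`: these instances hold with no other hypothesis used),
  `frobeniusProfileRigidity_iff_pos` (only `0 < C` carries content);
* §1 LOAD-BEARING HYPOTHESIS: `frobeniusProfileRigidity_false_without_mild` — the crux with ONLY the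
  Oseen–Duhamel identity dropped (keep the Type-I rate, joint continuity, `div v = 0` and
  `⟪v, curl v⟫ ≡ 0`) is FALSE: the parasitic slab flow `v(t,x) = (−t)^{−1/2} e₀` of
  Koch–Nadirashvili–Seregin–Šverák 2009 §1 (tree `Literature.Analysis.FluidPDE.parasiticVelocity`) is
  spatially constant, hence irrotational and helicity-free (`curl_parasiticVelocity`), divergence-free,
  smooth on the open slab, saturates the rate and is backward-singular at the origin
  (`parasitic_isBackwardSingularPoint_zero`).  So K2⁗ is NOT a kinematic statement about the
  complex-lamellar (Frobenius) class at the Type-I rate: any proof must use the equations (the mild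
  identity, which the parasitic flow violates — `e^{(t−s)Δ}` fixes constants while `b(t) ≠ b(s)`).

Summary for provers: the constant may be taken positive; the dynamics is load-bearing; a refutation of the
crux AS TYPED needs a backward-singular Type-I Oseen-mild ancient flow, i.e. a Type-I blow-up profile —
none is known (KNSS 2009; Albritton–Barker 2019 §1), so the crux is irrefutable by any construction in
print and sits one rung below the bounded-ancient Liouville conjecture restricted to `⟪v, curl v⟫ ≡ 0`.

## References

* G. Koch, N. Nadirashvili, G. Seregin, V. Šverák, Acta Math. 203 (2009) 83–105, §1 (parasitic
  solutions `u = b(t)`, `p = −b′(t)·x`; (1.4) the Type-I rate). [KNSS2009]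
* D. Albritton, T. Barker, J. Math. Fluid Mech. 21 (2019) = arXiv:1811.00502, §1 (backward singular
  points). [AlbrittonBarker2019]
-/

noncomputable section

open Set Filter Function MeasureTheory Metric TopologicalSpace
open scoped Topology ENNReal NNReal InnerProductSpace RealInnerProductSpace
open Literature.Analysis.FluidPDE Literature.Analysis.UnboundedOperators
open Summit.NavierStokesRegularity.NavierStokesRegularity.Theses.LocalHelicityTubeDoor

set_option linter.dupNamespace false

namespace Summit.NavierStokesRegularity.NavierStokesRegularity.Theorems.FrobeniusProfileRigidity.Negative

/-! ## §0 Normal form in the Type-I constant -/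

/-- A field vanishing on the open past slab has `ess sup = 0 ≠ ∞` on `Q_1(0,0)`, so the origin is not
backward-singular for it (Albritton–Barker 2019, §1: only times `< 0` enter). [folklore] -/
theorem not_isBackwardSingularPoint_zero_of_forall_eq_zero
    {u : ℝ → EuclideanSpace ℝ (Fin 3) → EuclideanSpace ℝ (Fin 3)} (h : ∀ t < 0, ∀ x, u t x = 0) :
    ¬ IsBackwardSingularPoint u 0 := by
  intro hs
  have h1 := hs 1 one_pos
  have hae : uncurry u =ᵐ[volume.restrict
      (parabolicCylinder 1 (0 : ℝ × EuclideanSpace ℝ (Fin 3)))] 0 := by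
    filter_upwards [ae_restrict_mem
      (isOpen_parabolicCylinder 1 (0 : ℝ × EuclideanSpace ℝ (Fin 3))).measurableSet] with z hz
    rw [mem_parabolicCylinder] at hz
    have ht : z.1 < 0 := by simpa using hz.1.2
    simp [uncurry, h z.1 ht z.2]
  rw [eLpNorm_congr_ae hae, eLpNorm_zero] at h1
  exact ENNReal.zero_ne_top h1

/-- DEGENERATE CONSTANTS: for `C ≤ 0` the Type-I rate `‖v t x‖ ≤ C/√(−t)` forces `v = 0` on the open
past slab, which is not backward-singular at the origin — these instances of the crux hold with no other
hypothesis used. [folklore] -/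
theorem frobeniusProfileRigidity_of_nonpos {C : ℝ} (hC : C ≤ 0)
    (v : ℝ → EuclideanSpace ℝ (Fin 3) → EuclideanSpace ℝ (Fin 3)) (hd : HasTypeITimeDecay C v) :
    ¬ IsBackwardSingularPoint v 0 := by
  refine not_isBackwardSingularPoint_zero_of_forall_eq_zero fun t ht x => ?_
  have h0 : C / Real.sqrt (-t) ≤ 0 := div_nonpos_iff.2 (Or.inr ⟨hC, Real.sqrt_nonneg _⟩)
  exact norm_le_zero_iff.1 ((hd t ht x).trans h0)

/-- Only the instances with `0 < C` carry content: the crux is equivalent to its restriction to positive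
Type-I constants (body verbatim otherwise). [folklore] -/
theorem frobeniusProfileRigidity_iff_pos :
    FrobeniusProfileRigidity ↔
      ∀ (C : ℝ), 0 < C → ∀ (v : ℝ → EuclideanSpace ℝ (Fin 3) → EuclideanSpace ℝ (Fin 3)),
        HasTypeITimeDecay C v →
        ContinuousOn (uncurry v) (Iio (0 : ℝ) ×ˢ univ) →
        (∀ s t : ℝ, s < t → t < 0 → ∀ x,
          v t x = heatExtension (v s) (t - s) x - oseenDuhamel 1 s v v t x) →
        (∀ t < 0, VectorCalculus.IsDivFree (v t)) →
        (∀ s < 0, ∀ y : EuclideanSpace ℝ (Fin 3), inner ℝ (v s y) (curl (v s) y) = 0) →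
        ¬ IsBackwardSingularPoint v 0 := by
  refine ⟨fun h C _ => h C, fun h C v hd hc hm hdiv hhel => ?_⟩
  rcases le_or_gt C 0 with hC | hC
  · exact frobeniusProfileRigidity_of_nonpos hC v hd
  · exact h C hC v hd hc hm hdiv hhel

/-! ## §1 The Navier–Stokes (Oseen–Duhamel) hypothesis is load-bearing -/

/-- The parasitic slab flow is spatially constant, hence irrotational: `curl v(s,·) = 0`
(KNSS 2009, §1). [cite: KNSS2009, §1] -/
theorem curl_parasiticVelocity (C s : ℝ) (y : EuclideanSpace ℝ (Fin 3)) :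
    curl (parasiticVelocity C s) y = 0 := by
  have hv : parasiticVelocity C s = fun _ : EuclideanSpace ℝ (Fin 3) => parasiticAmp C s • parasiticDir :=
    rfl
  rw [hv]
  ext i
  fin_cases i <;> simp [curl]

/-- In particular the parasitic slab flow is helicity-free on every slice. [cite: KNSS2009, §1] -/
theorem helicity_parasiticVelocity (C s : ℝ) (y : EuclideanSpace ℝ (Fin 3)) :
    inner ℝ (parasiticVelocity C s y) (curl (parasiticVelocity C s) y) = 0 := by
  rw [curl_parasiticVelocity, inner_zero_right]

/-- **`FrobeniusProfileRigidity` minus the mild identity is FALSE.**  Drop ONLY the Oseen–Duhamel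
hypothesis `v t = e^{(t−s)Δ} v s − B¹_s(v,v)(t)` of the crux and keep the Type-I rate, joint continuity on
the open past slab, `div v(t) = 0` and the helicity-free condition `⟪v(s,·), curl v(s,·)⟫ ≡ 0`: the
resulting statement fails, witnessed by the parasitic slab flow `v(t,x) = (−t)^{−1/2} e₀` (KNSS 2009 §1,
tree `parasiticVelocity 1`), which has the rate with constant `1`, is smooth on the slab, divergence-free
and helicity-free, and is backward-singular at the origin.  Hence any proof of the crux must use the
Navier–Stokes dynamics; the statement is not a kinematic fact about the complex-lamellar class at the
Type-I rate. [cite: KNSS2009, §1 and (1.4)] -/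
theorem frobeniusProfileRigidity_false_without_mild :
    ¬ ∀ (C : ℝ) (v : ℝ → EuclideanSpace ℝ (Fin 3) → EuclideanSpace ℝ (Fin 3)),
        HasTypeITimeDecay C v →
        ContinuousOn (uncurry v) (Iio (0 : ℝ) ×ˢ univ) →
        (∀ t < 0, VectorCalculus.IsDivFree (v t)) →
        (∀ s < 0, ∀ y : EuclideanSpace ℝ (Fin 3), inner ℝ (v s y) (curl (v s) y) = 0) →
        ¬ IsBackwardSingularPoint v 0 := fun h =>
  h 1 (parasiticVelocity 1) (parasitic_hasTypeITimeDecay zero_le_one)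
    (contDiffOn_parasiticVelocity 1 (n := 0)).continuousOn
    (fun t _ => isDivFree_parasiticVelocity 1 t)
    (fun s _ y => helicity_parasiticVelocity 1 s y)
    (parasitic_isBackwardSingularPoint_zero one_pos)

end Summit.NavierStokesRegularity.NavierStokesRegularity.Theorems.FrobeniusProfileRigidity.Negative

end
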